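import Summits.Ventures.PercRepro.C041TriangleMarkedSmall
import Summits.Ventures.PercRepro.C041TriangleLeafStar3
import Summits.Ventures.PercRepro.C041TriangleLeafStar3Mark
import Summits.Ventures.PercRepro.C041TriangleLeafMarkStar3
import Summits.Ventures.PercRepro.C041TriangleLeafMarkStar3Mark
import Summits.Ventures.PercRepro.C041TriangleLeafMarkStar3Mark0

/-!
# THE TRIANGLE ON A LEAF AND A THREE-LEAF STAR WITH ARBITRARY MARKS (mine-3, gen 67; C-041.md §21 (bg))

The nine seeds of `InCone_thetaTri_marks_of_seeds_pair` for `w = v d`, `w′ = v a * v b * v c`: THEOREM (LEAF ×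
THREE-LEAF STAR) and the four kit certificates `InCone_thetaTri_leafStar3Mark` (`θ_△(v d, v a v b v c · v 1)`),
`InCone_thetaTri_leafMarkStar3` (`θ_△(v d · v 1, v a v b v c)`), `InCone_thetaTri_leafMarkStar3Mark`,
`InCone_thetaTri_leafMarkStar3Mark0`, with their mirrors under `sw`.  THEOREM `InCone_thetaTri_leafMarks_star3Marks`:
`θ_△(v d · X(p,q), v a v b v c · X(p′,q′)) ∈ cone` for all marks — every pair of stars with at most one and at most
three INTERIOR leaves is settled, whatever the marks.
-/

namespace PercRepro

namespace RelaxedTriangle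

open TreeClosure

/-- The mirror of `θ_△(v d, v a v b v c · v 1)`: the 2-mark. -/
theorem InCone_thetaTri_leafStar3Mark0 (a b c d : ℝ) (ha : 0 ≤ a ∧ a ≤ 1) (hb : 0 ≤ b ∧ b ≤ 1) (hc : 0 ≤ c ∧ c ≤ 1)
    (hd : 0 ≤ d ∧ d ≤ 1) : InCone (thetaTri (v d) (v a * v b * v c * v 0)) := by
  have h := InCone_thetaTri_leafStar3Mark (1 - a) (1 - b) (1 - c) (1 - d) ⟨by linarith [ha.2], by linarith [ha.1]⟩
    ⟨by linarith [hb.2], by linarith [hb.1]⟩ ⟨by linarith [hc.2], by linarith [hc.1]⟩ ⟨by linarith [hd.2], by linarith [hd.1]⟩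
  rw [← InCone_thetaTri_sw_iff] at h
  simp only [sw_mul, sw_v] at h
  simpa using h

/-- The mirror of `θ_△(v d · v 1, v a v b v c)`. -/
theorem InCone_thetaTri_leafMark0Star3 (a b c d : ℝ) (ha : 0 ≤ a ∧ a ≤ 1) (hb : 0 ≤ b ∧ b ≤ 1) (hc : 0 ≤ c ∧ c ≤ 1)
    (hd : 0 ≤ d ∧ d ≤ 1) : InCone (thetaTri (v d * v 0) (v a * v b * v c)) := by
  have h := InCone_thetaTri_leafMarkStar3 (1 - a) (1 - b) (1 - c) (1 - d) ⟨by linarith [ha.2], by linarith [ha.1]⟩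
    ⟨by linarith [hb.2], by linarith [hb.1]⟩ ⟨by linarith [hc.2], by linarith [hc.1]⟩ ⟨by linarith [hd.2], by linarith [hd.1]⟩
  rw [← InCone_thetaTri_sw_iff] at h
  simp only [sw_mul, sw_v] at h
  simpa using h

/-- The mirror of `θ_△(v d · v 1, v a v b v c · v 1)`: two 2-marks. -/
theorem InCone_thetaTri_leafMark0Star3Mark0 (a b c d : ℝ) (ha : 0 ≤ a ∧ a ≤ 1) (hb : 0 ≤ b ∧ b ≤ 1)
    (hc : 0 ≤ c ∧ c ≤ 1) (hd : 0 ≤ d ∧ d ≤ 1) : InCone (thetaTri (v d * v 0) (v a * v b * v c * v 0)) := by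
  have h := InCone_thetaTri_leafMarkStar3Mark (1 - a) (1 - b) (1 - c) (1 - d) ⟨by linarith [ha.2], by linarith [ha.1]⟩
    ⟨by linarith [hb.2], by linarith [hb.1]⟩ ⟨by linarith [hc.2], by linarith [hc.1]⟩ ⟨by linarith [hd.2], by linarith [hd.1]⟩
  rw [← InCone_thetaTri_sw_iff] at h
  simp only [sw_mul, sw_v] at h
  simpa using h

/-- The mirror of `θ_△(v d · v 1, v a v b v c · v 0)`: a 2-mark against a 1-mark. -/
theorem InCone_thetaTri_leafMark0Star3Mark (a b c d : ℝ) (ha : 0 ≤ a ∧ a ≤ 1) (hb : 0 ≤ b ∧ b ≤ 1)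
    (hc : 0 ≤ c ∧ c ≤ 1) (hd : 0 ≤ d ∧ d ≤ 1) : InCone (thetaTri (v d * v 0) (v a * v b * v c * v 1)) := by
  have h := InCone_thetaTri_leafMarkStar3Mark0 (1 - a) (1 - b) (1 - c) (1 - d) ⟨by linarith [ha.2], by linarith [ha.1]⟩
    ⟨by linarith [hb.2], by linarith [hb.1]⟩ ⟨by linarith [hc.2], by linarith [hc.1]⟩ ⟨by linarith [hd.2], by linarith [hd.1]⟩
  rw [← InCone_thetaTri_sw_iff] at h
  simp only [sw_mul, sw_v] at h
  simpa using h

/-- **THEOREM (A LEAF AND A THREE-LEAF STAR WITH ANY MARKS)**: `θ_△(v d · X(p,q), v a v b v c · X(p′,q′)) ∈ cone`. -/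
theorem InCone_thetaTri_leafMarks_star3Marks (a b c d : ℝ) (ha : 0 ≤ a ∧ a ≤ 1) (hb : 0 ≤ b ∧ b ≤ 1)
    (hc : 0 ≤ c ∧ c ≤ 1) (hd : 0 ≤ d ∧ d ≤ 1) (p q p' q' : ℕ) :
    InCone (thetaTri (v d * (v 1 ^ p * v 0 ^ q)) (v a * v b * v c * (v 1 ^ p' * v 0 ^ q'))) :=
  InCone_thetaTri_marks_of_seeds_pair (InCone_v d hd) (((InCone_v a ha).mul (InCone_v b hb)).mul (InCone_v c hc))
    (InCone_thetaTri_leafStar3 a b c d ha hb hc hd) (InCone_thetaTri_leafStar3Mark a b c d ha hb hc hd)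
    (InCone_thetaTri_leafStar3Mark0 a b c d ha hb hc hd) (InCone_thetaTri_leafMarkStar3 a b c d ha hb hc hd)
    (InCone_thetaTri_leafMark0Star3 a b c d ha hb hc hd) (InCone_thetaTri_leafMarkStar3Mark a b c d ha hb hc hd)
    (InCone_thetaTri_leafMarkStar3Mark0 a b c d ha hb hc hd) (InCone_thetaTri_leafMark0Star3Mark a b c d ha hb hc hd)
    (InCone_thetaTri_leafMark0Star3Mark0 a b c d ha hb hc hd) p q p' q'

/-- The pure form: `θ_△(v d, v a v b v c · X(p,q)) ∈ cone` for all `p, q`. -/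
theorem InCone_thetaTri_leaf_star3_marks (a b c d : ℝ) (ha : 0 ≤ a ∧ a ≤ 1) (hb : 0 ≤ b ∧ b ≤ 1) (hc : 0 ≤ c ∧ c ≤ 1)
    (hd : 0 ≤ d ∧ d ≤ 1) (p q : ℕ) : InCone (thetaTri (v d) (v a * v b * v c * (v 1 ^ p * v 0 ^ q))) := by
  have h := InCone_thetaTri_leafMarks_star3Marks a b c d ha hb hc hd 0 0 p q
  simpa using h

end RelaxedTriangle

end PercRepro
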